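import Summits.AnomalousDissipation.AnomalousDissipation.Theorems.SawtoothPulseCascadeK1LocalisedCascadeKHSheetReduction
import Summits.AnomalousDissipation.AnomalousDissipation.Theorems.SawtoothPulseCascadeK1LocalisedCascadeKHSheetPrimitives

/-!
# K2 lane (route-2 `SawtoothPulseCascade`, crux dir `K1LocalisedCascade`): S2 (homogeneous) from a θ-FREE scalar bound

Helper file of the K2 lane (S2 `KHSheetAbsolute γ B`; ACL item stmt-AnomalousDissipation-19491). Final reduction of the homogeneous S2
constant: for the line `k > 0` with Bloch phase `β`, write `σ = sawSigma k β` (modal rate; `0` on stable/neutral classes),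
`F∓ = π/2 − sinh πk/(k(cosh πk ∓ |cos πβ|))`, `ρ = (cosh πk − |cos πβ|)/(cosh πk + |cos πβ|)` and `W = ½(F₋²ρ + F₊²/ρ)`
(`sheetW_eq_productForm`). If `T ≥ γ ≥ 0` and `sinh(γσ) ≤ Tσ` (i.e. `T ≥ sinh(γσ)/σ`), then

  `2 cosh²(γσ) + 2 T² k² W ≤ B²  ⇒  khForm(q θ) ≤ B²·khForm(q 0)` for every S2-stub solution `q` on `[0,γ]`

(`sheet_energy_le_of_sigma_bound`): along the three propagator pairs `C² ≤ cosh²(γσ)` and `Sn² ≤ T²` (unstable: `cosh`, `sinh` monotone;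
stable: `cos² ≤ 1`, `|sin ωθ/ω| ≤ θ`; neutral: `(1, θ)`), fed into `sheet_energy_le_of_trace_table`. So the S2 certificate per class box
needs only an upper bound for `σ` (the S1 machinery `sawSigma_sq_le_of_cos_sq_le`, Bloch domination `sq_mul_neg_sawC2_le_max`) and for
`k²W` through the monotone primitives `F₋, F₊, ρ`. No definitions; no statement about the crux.
[cite: Drazin2002, §8.3 (8.36)–(8.38) (Rayleigh jump conditions at the kinks of a broken-line profile)] [problem: turb]
-/

-- `Summit.<Summit>.<Problem>`: single-conjunct summit, the duplicate namespace segment is deliberate.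
set_option linter.dupNamespace false

noncomputable section

namespace Summit.AnomalousDissipation.AnomalousDissipation.Theorems.SawtoothPulseCascade.K2PhaseBudget

open Set Real Complex Literature.Analysis.FluidPDE.SawtoothCascade

/-- `sawSigma k β ^ 2 = −k²c²(k,β)` on unstable classes and `sawSigma = 0` otherwise (`k ≥ 0`). [folklore] -/
theorem sawSigma_sq_eq_max (k β : ℝ) :
    sawSigma k β ^ 2 = max 0 (-(k ^ 2 * sawC2 k β)) := by
  unfold sawSigma
  rw [mul_pow, Real.sq_sqrt (le_max_left _ _), mul_max_of_nonneg _ _ (sq_nonneg k), mul_zero]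
  ring_nf

/-- **S2 (homogeneous) from a θ-free scalar bound.** See the module docstring. [cite: Drazin2002, §8.3 (8.36)–(8.38)] -/
theorem sheet_energy_le_of_sigma_bound {k β γ B T : ℝ} (hk : 0 < k) (hγ : 0 ≤ γ) (hT : γ ≤ T)
    (hTs : Real.sinh (γ * sawSigma k β) ≤ T * sawSigma k β)
    {p S : ℂ} {m : ℝ} {F : (Fin 2 → ℂ) → (Fin 2 → ℂ)}
    (hp : p = ((π / 2 + 2 * sawSigma0 k β : ℝ) : ℂ)) (hS : S = sawS k β) (hm : m = -sawSigma0 k β)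
    (hF : F = fun v => ![I * k * (-p * v 0 - 2 * S * v 1), I * k * (2 * (starRingEnd ℂ) S * v 0 + p * v 1)])
    (hB : 2 * Real.cosh (γ * sawSigma k β) ^ 2 + 2 * T ^ 2 * k ^ 2 *
        (((π / 2 - Real.sinh (π * k) / (k * (Real.cosh (π * k) - |Real.cos (π * β)|))) ^ 2 *
              ((Real.cosh (π * k) - |Real.cos (π * β)|) / (Real.cosh (π * k) + |Real.cos (π * β)|)) +
            (π / 2 - Real.sinh (π * k) / (k * (Real.cosh (π * k) + |Real.cos (π * β)|))) ^ 2 *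
              ((Real.cosh (π * k) + |Real.cos (π * β)|) / (Real.cosh (π * k) - |Real.cos (π * β)|))) / 2) ≤ B ^ 2)
    {q : ℝ → (Fin 2 → ℂ)} (hq : ∀ θ ∈ Icc (0 : ℝ) γ, HasDerivWithinAt q (F (q θ)) (Icc (0 : ℝ) γ) θ) :
    ∀ θ ∈ Icc (0 : ℝ) γ,
      m * (Complex.normSq (q θ 0) + Complex.normSq (q θ 1)) - 2 * ((starRingEnd ℂ) (q θ 0) * S * q θ 1).re ≤
        B ^ 2 * (m * (Complex.normSq (q 0 0) + Complex.normSq (q 0 1)) - 2 * ((starRingEnd ℂ) (q 0 0) * S * q 0 1).re) := by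
  subst hS
  -- the trace weight in product form, and its nonnegativity
  have hW := sheetW_eq_productForm hk β hm
  set Wp := ((π / 2 - Real.sinh (π * k) / (k * (Real.cosh (π * k) - |Real.cos (π * β)|))) ^ 2 *
        ((Real.cosh (π * k) - |Real.cos (π * β)|) / (Real.cosh (π * k) + |Real.cos (π * β)|)) +
      (π / 2 - Real.sinh (π * k) / (k * (Real.cosh (π * k) + |Real.cos (π * β)|))) ^ 2 *
        ((Real.cosh (π * k) + |Real.cos (π * β)|) / (Real.cosh (π * k) - |Real.cos (π * β)|))) / 2 with hWp
  have hx : 0 < π * k := by positivity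
  have hC1 : 1 < Real.cosh (π * k) := Real.one_lt_cosh.2 hx.ne'
  have hγ1 : |Real.cos (π * β)| ≤ 1 := Real.abs_cos_le_one _
  have hγ0 : 0 ≤ |Real.cos (π * β)| := abs_nonneg _
  have hWp0 : 0 ≤ Wp := by
    rw [hWp]
    have h1 : 0 < Real.cosh (π * k) - |Real.cos (π * β)| := by linarith
    have h2 : 0 < Real.cosh (π * k) + |Real.cos (π * β)| := by linarith
    positivity
  set σ := sawSigma k β with hσ
  have hσ0 : 0 ≤ σ := mul_nonneg hk.le (Real.sqrt_nonneg _)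
  have hT0 : 0 ≤ T := hγ.trans hT
  -- generic consequence of `C² ≤ cosh²(γσ)`, `Sn² ≤ T²`
  have key : ∀ C Sn : ℝ, C ^ 2 ≤ Real.cosh (γ * σ) ^ 2 → Sn ^ 2 ≤ T ^ 2 →
      2 * (C ^ 2 + Sn ^ 2 * k ^ 2 *
        (((m * (π / 2 - 2 * m) ^ 2 + 4 * Complex.normSq (sawS k β) * ((π / 2 - 2 * m) + m)) * m +
          ((π / 2 - 2 * m) ^ 2 + 4 * m * (π / 2 - 2 * m) + 4 * Complex.normSq (sawS k β)) * Complex.normSq (sawS k β)) /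
          (m ^ 2 - Complex.normSq (sawS k β)))) ≤ B ^ 2 := by
    intro C Sn hC hSn
    rw [hW]
    have h1 : Sn ^ 2 * k ^ 2 * Wp ≤ T ^ 2 * k ^ 2 * Wp := by
      have : 0 ≤ k ^ 2 * Wp := by positivity
      nlinarith
    linarith
  apply sheet_energy_le_of_trace_table hk hp rfl hm hF _ hq
  intro θ hθ C Sn hpair
  rcases hpair with ⟨hneg, hC, hSn⟩ | ⟨hpos, hC, hSn⟩ | ⟨hzero, hC, hSn⟩
  · -- unstable: `C = cosh(σθ)`, `Sn = sinh(σθ)/σ`, `σ > 0`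
    have hσ2 : σ ^ 2 = -(k ^ 2 * sawC2 k β) := by
      rw [hσ, sawSigma_sq_eq_max, max_eq_right]; nlinarith [mul_pos (pow_pos hk 2) (neg_pos.2 hneg)]
    have hσpos : 0 < σ := by
      rcases hσ0.eq_or_lt with h | h
      · rw [← h] at hσ2; nlinarith [mul_pos (pow_pos hk 2) (neg_pos.2 hneg)]
      · exact h
    have hθσ : σ * θ ≤ γ * σ := by rw [mul_comm]; exact mul_le_mul_of_nonneg_right hθ.2 hσ0
    have hθσ0 : 0 ≤ σ * θ := mul_nonneg hσ0 hθ.1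
    apply key
    · rw [hC]
      have h1 : Real.cosh (σ * θ) ≤ Real.cosh (γ * σ) := by
        rw [Real.cosh_le_cosh, abs_of_nonneg hθσ0, abs_of_nonneg (mul_nonneg hγ hσ0)]; exact hθσ
      exact pow_le_pow_left₀ (Real.cosh_pos _).le h1 2
    · rw [hSn]
      have h1 : Real.sinh (σ * θ) ≤ Real.sinh (γ * σ) := Real.sinh_le_sinh.2 hθσ
      have h2 : 0 ≤ Real.sinh (σ * θ) := Real.sinh_nonneg_iff.2 hθσ0
      have h3 : Real.sinh (σ * θ) / σ ≤ T := by
        rw [div_le_iff₀ hσpos]; linarith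
      have h4 : 0 ≤ Real.sinh (σ * θ) / σ := div_nonneg h2 hσ0
      exact pow_le_pow_left₀ h4 h3 2
  · -- stable: `C = cos(ωθ)`, `Sn = sin(ωθ)/ω`
    have hω0 : 0 < k * Real.sqrt (sawC2 k β) := mul_pos hk (Real.sqrt_pos.2 hpos)
    apply key
    · rw [hC]
      have h1 : Real.cos (k * Real.sqrt (sawC2 k β) * θ) ^ 2 ≤ 1 := by
        rw [sq_le_one_iff_abs_le_one]; exact Real.abs_cos_le_one _
      have h2 : 1 ≤ Real.cosh (γ * σ) ^ 2 := by
        have := Real.one_le_cosh (γ * σ)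
        nlinarith
      linarith
    · rw [hSn]
      have h1 : |Real.sin (k * Real.sqrt (sawC2 k β) * θ) / (k * Real.sqrt (sawC2 k β))| ≤ T := by
        rw [abs_div, abs_of_pos hω0, div_le_iff₀ hω0]
        calc |Real.sin (k * Real.sqrt (sawC2 k β) * θ)| ≤ |k * Real.sqrt (sawC2 k β) * θ| := Real.abs_sin_le_abs
          _ = k * Real.sqrt (sawC2 k β) * θ := abs_of_nonneg (mul_nonneg hω0.le hθ.1)
          _ ≤ T * (k * Real.sqrt (sawC2 k β)) := by nlinarith [hθ.2]
      have := sq_le_sq' (abs_le.1 h1).1 (abs_le.1 h1).2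
      simpa using this
  · -- neutral: `C = 1`, `Sn = θ`
    apply key
    · rw [hC]
      have := Real.one_le_cosh (γ * σ)
      nlinarith
    · rw [hSn]
      exact pow_le_pow_left₀ hθ.1 (hθ.2.trans hT) 2

end Summit.AnomalousDissipation.AnomalousDissipation.Theorems.SawtoothPulseCascade.K2PhaseBudget

end
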